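import Summits.Ventures.PercRepro.C026HubPairDefs
import Summits.Ventures.PercRepro.C026GluingMinor

/-!
# Hub-pair graphs, VIII: C-026 on every hub-pair multigraph (p5, gen 11)

mine-3's hub-pair theorem (§25.2) in the kernel:

* **`dFreeIneq_of_hubPair`** — `(★)`, the D-free inequality, on every hub-pair multigraph with three
  distinct marks (strong induction on the edges through the composition theorem: the edges at a
  non-mark and its partner are a pair gadget, the rest a smaller hub-pair graph);
* **`hubPair_cubeSumQuad_nonneg`** — the class-level form `0 ≤ CS₂₆` (`(★) ⟹ (CF′)`);
* **`IsHubPairGraph.minor`** — marked minors of hub-pair graphs are hub-pair graphs (the class of a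
  non-mark in the contraction is `{z}` or `{z, π(z)}`);
* **`c026_hubPair`** — C-026 at every `p ∈ [0,1]^E`: `(x + y₁)(y₁ + z) ≤ y₁ + y₂ + y₃`, i.e.
  `P(a~b)·P(c ≁ {a,b}) ≤ P(one pair)`, on every hub-pair multigraph (`c026_of_dFree_minors`).
-/

universe u

namespace PercRepro

namespace MultiGraph

open PairModel

variable {V : Type*}

/-- The pair side with `y = x` is supported on `a, b, c, x`. -/
theorem supported_of_supported5_eq {E : Type*} {G : MultiGraph V E} {a b c x : V}
    (h : G.Supported (pairIota a b c x x) 5) : G.Supported (pairIota a b c x x) 4 := by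
  intro e
  obtain ⟨⟨i, hi, hf⟩, ⟨j, hj, hs⟩⟩ := h e
  have h34 : pairIota a b c x x 4 = pairIota a b c x x 3 := by simp [pairIota]
  refine ⟨?_, ?_⟩
  · rcases Nat.lt_or_ge i 4 with hi' | hi'
    · exact ⟨i, hi', hf⟩
    · have : i = 4 := by omega
      subst this
      exact ⟨3, by norm_num, hf.trans h34⟩
  · rcases Nat.lt_or_ge j 4 with hj' | hj'
    · exact ⟨j, hj', hs⟩
    · have : j = 4 := by omega
      subst this
      exact ⟨3, by norm_num, hs.trans h34⟩

/-- **The D-free inequality on every hub-pair multigraph** (three distinct marks), by strong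
induction on the number of edges. -/
theorem dFreeIneq_of_hubPair_card (a b c : V) (hab : a ≠ b) (hac : a ≠ c) (hbc : b ≠ c) :
    ∀ m : ℕ, ∀ {E : Type u} [Fintype E] [DecidableEq E] (G : MultiGraph V E),
      Fintype.card E = m → G.IsHubPairGraph a b c → G.DFreeIneq a b c := by
  intro m
  induction m using Nat.strong_induction_on with
  | _ m ih =>
  intro E _ _ G hm hG
  classical
  by_cases hex : ∃ x, (x ≠ a ∧ x ≠ b ∧ x ≠ c) ∧ ∃ e, G.EdgeAt e x
  · obtain ⟨x, hx, e₀, he₀⟩ := hex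
    have hside₀ : ¬ G.splitSide x x e₀ = false := by
      intro h
      have := (splitSide_eq_true_iff (x := x) (y := x) e₀).2 (Or.inl he₀)
      rw [this] at h
      exact absurd h (by decide)
    by_cases hp : ∃ w, (w ≠ a ∧ w ≠ b ∧ w ≠ c) ∧ w ≠ x ∧ ∃ e, G.Joins e x w
    · -- the pair `x, y`
      obtain ⟨y, hy, hyx', e₁, he₁⟩ := hp
      have hxy : ∀ e w, G.Joins e x w → w ≠ x → (w ≠ a ∧ w ≠ b ∧ w ≠ c) → w = y :=
        fun e w he hwx hw => hG x hx.1 hx.2.1 hx.2.2 e e₁ w y he he₁ hwx hyx' hw hy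
      have hyx : ∀ e w, G.Joins e y w → w ≠ y → (w ≠ a ∧ w ≠ b ∧ w ≠ c) → w = x :=
        fun e w he hwy hw => hG y hy.1 hy.2.1 hy.2.2 e e₁ w x he he₁.symm hwy (Ne.symm hyx') hw hx
      have hg := isGluing_splitSide hx hy hxy hyx
      obtain ⟨hsup, hnm⟩ := supported_part_splitSide hx hy hxy hyx
      have h₁ : (G.part (G.splitSide x y) true).DFreeIneq a b c :=
        dFreeIneq_of_supported5 hsup (injBelow_pairIota hab hac hbc hx hy (Ne.symm hyx')) hnm
      have hside : ¬ G.splitSide x y e₀ = false := by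
        intro h
        have := (splitSide_eq_true_iff (x := x) (y := y) e₀).2 (Or.inl he₀)
        rw [this] at h
        exact absurd h (by decide)
      have hcard : Fintype.card {e // G.splitSide x y e = false} < m := by
        rw [← hm]
        exact Fintype.card_subtype_lt hside
      have h₀ := ih _ hcard (G.part (G.splitSide x y) false) rfl (hG.part _ _)
      exact dFreeIneq_of_gluing G a b c hab hac hbc _ hg h₁ h₀
    · -- a single hub `x` (with loops)
      have hxy : ∀ e w, G.Joins e x w → w ≠ x → (w ≠ a ∧ w ≠ b ∧ w ≠ c) → w = x := by
        intro e w he hwx hw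
        exact absurd ⟨w, hw, hwx, e, he⟩ hp
      have hg := isGluing_splitSide hx hx hxy hxy
      obtain ⟨hsup, hnm⟩ := supported_part_splitSide hx hx hxy hxy
      have hnm' : ∀ e : {e // G.splitSide x x e = true}, ∃ k, 3 ≤ k ∧ k < 4 ∧
          ((G.part (G.splitSide x x) true).fst e = pairIota a b c x x k ∨
            (G.part (G.splitSide x x) true).snd e = pairIota a b c x x k) := by
        intro e
        obtain ⟨k, hk3, hk, hke⟩ := hnm e
        have h34 : pairIota a b c x x 4 = pairIota a b c x x 3 := by simp [pairIota]
        rcases Nat.lt_or_ge k 4 with hk' | hk'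
        · exact ⟨k, hk3, hk', hke⟩
        · have : k = 4 := by omega
          subst this
          rw [h34] at hke
          exact ⟨3, by norm_num, by norm_num, hke⟩
      have h₁ : (G.part (G.splitSide x x) true).DFreeIneq a b c :=
        dFreeIneq_of_supported4 (supported_of_supported5_eq hsup)
          (injBelow_pairIota4 (y := x) hab hac hbc hx) hnm'
      have hcard : Fintype.card {e // G.splitSide x x e = false} < m := by
        rw [← hm]
        exact Fintype.card_subtype_lt hside₀
      have h₀ := ih _ hcard (G.part (G.splitSide x x) false) rfl (hG.part _ _)
      exact dFreeIneq_of_gluing G a b c hab hac hbc _ hg h₁ h₀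
  · -- no edge at a non-mark: supported on the marks
    have hsup : G.Supported (pairIota a b c a a) 3 := by
      intro e
      have hmark : ∀ w, G.EdgeAt e w → ∃ i < 3, w = pairIota a b c a a i := by
        intro w hw
        by_cases hwm : w = a ∨ w = b ∨ w = c
        · rcases hwm with rfl | rfl | rfl
          · exact ⟨0, by norm_num, rfl⟩
          · exact ⟨1, by norm_num, rfl⟩
          · exact ⟨2, by norm_num, rfl⟩
        · exfalso
          exact hex ⟨w, ⟨fun h => hwm (Or.inl h), fun h => hwm (Or.inr (Or.inl h)),
            fun h => hwm (Or.inr (Or.inr h))⟩, e, hw⟩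
      exact ⟨hmark _ (Or.inl rfl), hmark _ (Or.inr rfl)⟩
    have hinj : InjBelow (pairIota a b c a a) 3 := by
      intro i hi j hj h
      interval_cases i <;> interval_cases j <;> simp [pairIota] at h ⊢ <;>
        first
        | exact absurd h hab | exact absurd h hac | exact absurd h hbc
        | exact absurd h hab.symm | exact absurd h hac.symm | exact absurd h hbc.symm
    exact dFreeIneq_of_supported3 hsup hinj

/-- **The D-free inequality `(★)` on every hub-pair multigraph** with three distinct marks
(mine-3's Theorem 25.2). -/
theorem dFreeIneq_of_hubPair {E : Type u} [Fintype E] [DecidableEq E] (G : MultiGraph V E)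
    {a b c : V} (hG : G.IsHubPairGraph a b c) (hab : a ≠ b) (hac : a ≠ c) (hbc : b ≠ c) :
    G.DFreeIneq a b c :=
  dFreeIneq_of_hubPair_card a b c hab hac hbc _ G rfl hG

/-- **The class-level form**: `0 ≤ CS₂₆(G; a, b, c)` on every hub-pair multigraph. -/
theorem hubPair_cubeSumQuad_nonneg {E : Type u} [Fintype E] [DecidableEq E] (G : MultiGraph V E)
    {a b c : V} (hG : G.IsHubPairGraph a b c) (hab : a ≠ b) (hac : a ≠ c) (hbc : b ≠ c) :
    0 ≤ G.cubeSumQuad ![a, b, c] kernel26 := by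
  classical
  exact (G.cubeSumQuad_kernel26_nonneg_iff_M a b c).mpr
    (G.card_botM_le_of_dFree (dFreeIneq_of_hubPair G hG hab hac hbc))

/-! ### Minors -/

/-- A vertex of a non-mark class of the minor is a non-mark. -/
theorem nonMark_of_sureClass_ne {E : Type*} (G : MultiGraph V E) {a b c : V} (v : Config E)
    {z' : Quotient (G.connSetoid v)} (hza : z' ≠ G.sureClass v a) (hzb : z' ≠ G.sureClass v b)
    (hzc : z' ≠ G.sureClass v c) {t : V} (ht : G.sureClass v t = z') : t ≠ a ∧ t ≠ b ∧ t ≠ c :=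
  ⟨fun h => hza (ht ▸ h ▸ rfl), fun h => hzb (ht ▸ h ▸ rfl), fun h => hzc (ht ▸ h ▸ rfl)⟩

/-- A walk to a different vertex starts with a step to a different vertex. -/
theorem exists_openAdj_ne_of_conn {E : Type*} {G : MultiGraph V E} {v : Config E} {z z₂ : V}
    (h : G.Conn v z z₂) (hne : z ≠ z₂) : ∃ t, t ≠ z ∧ G.OpenAdj v z t := by
  induction h using Relation.ReflTransGen.head_induction_on with
  | refl => exact absurd rfl hne
  | @head a c hac _ ih =>
    by_cases hca : c = a
    · subst hca
      exact ih hne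
    · exact ⟨c, hca, hac⟩

/-- **Marked minors of hub-pair graphs are hub-pair graphs.** -/
theorem IsHubPairGraph.minor {E : Type*} {G : MultiGraph V E} {a b c : V}
    (hG : G.IsHubPairGraph a b c) (u v : Config E) :
    (G.minor u v).IsHubPairGraph (G.sureClass v a) (G.sureClass v b) (G.sureClass v c) := by
  intro z' hza hzb hzc e e' w' w'' he he' hw'z hw''z hw' hw''
  -- the underlying edges
  have lift : ∀ (f : Face u v) (q q' : Quotient (G.connSetoid v)), (G.minor u v).Joins f q q' →
      ∃ z w, G.sureClass v z = q ∧ G.sureClass v w = q' ∧ G.Joins f.1 z w := by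
    intro f q q' h
    rcases h with ⟨h1, h2⟩ | ⟨h1, h2⟩
    · exact ⟨G.fst f.1, G.snd f.1, h1, h2, Or.inl ⟨rfl, rfl⟩⟩
    · exact ⟨G.snd f.1, G.fst f.1, h2, h1, Or.inr ⟨rfl, rfl⟩⟩
  obtain ⟨z₁, w₁, hz₁, hw₁, hj₁⟩ := lift e z' w' he
  obtain ⟨z₂, w₂, hz₂, hw₂, hj₂⟩ := lift e' z' w'' he'
  have hz₁m := nonMark_of_sureClass_ne G v hza hzb hzc hz₁
  have hz₂m := nonMark_of_sureClass_ne G v hza hzb hzc hz₂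
  have hw₁m := nonMark_of_sureClass_ne G v hw'.1 hw'.2.1 hw'.2.2 hw₁
  have hw₂m := nonMark_of_sureClass_ne G v hw''.1 hw''.2.1 hw''.2.2 hw₂
  have hw₁z : w₁ ≠ z₁ := fun h => hw'z (hw₁.symm.trans (h ▸ hz₁))
  have hw₂z : w₂ ≠ z₂ := fun h => hw''z (hw₂.symm.trans (h ▸ hz₂))
  -- the partner of a vertex of the class lies in the class when the class has two vertices
  have key : ∀ (f : E) (z w z₂ : V), G.sureClass v z = z' → G.Joins f z w → w ≠ z →
      (w ≠ a ∧ w ≠ b ∧ w ≠ c) → G.sureClass v z₂ = z' → z ≠ z₂ → G.sureClass v w = z' := by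
    intro f z w z₂ hz hj hwz hw hz₂ hne
    have hconn : G.Conn v z z₂ := (G.sureClass_eq_iff v z z₂).1 (hz.trans hz₂.symm)
    obtain ⟨t, htz, hzt⟩ := exists_openAdj_ne_of_conn hconn hne
    obtain ⟨g, _, hg⟩ := hzt
    have htz' : G.sureClass v t = z' := by
      rw [← hz]
      exact (G.sureClass_eq_iff v t z).2 (Conn.of_openAdj ⟨g, by assumption, hg⟩).symm
    have htm := nonMark_of_sureClass_ne G v hza hzb hzc htz'
    have hzm := nonMark_of_sureClass_ne G v hza hzb hzc hz
    have := hG z hzm.1 hzm.2.1 hzm.2.2 f g w t hj hg hwz htz hw htm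
    rw [this]
    exact htz'
  by_cases hzz : z₁ = z₂
  · subst hzz
    have := hG z₁ hz₁m.1 hz₁m.2.1 hz₁m.2.2 e.1 e'.1 w₁ w₂ hj₁ hj₂ hw₁z hw₂z hw₁m hw₂m
    rw [← hw₁, ← hw₂, this]
  · have h1 := key e.1 z₁ w₁ z₂ hz₁ hj₁ hw₁z hw₁m hz₂ hzz
    have h2 := key e'.1 z₂ w₂ z₁ hz₂ hj₂ hw₂z hw₂m hz₁ (Ne.symm hzz)
    rw [← hw₁, ← hw₂, h1, h2]

/-- **C-026 on every hub-pair multigraph at every `p`** (mine-3 §25.2): for every hub-pair multigraph,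
every `p ∈ [0,1]^E` and the marks `a, b, c`, `(x + y₁)(y₁ + z) ≤ y₁ + y₂ + y₃`, i.e.
`P(a~b)·P(c ≁ {a,b}) ≤ P(one pair)`. -/
theorem c026_hubPair {E : Type u} [Fintype E] [DecidableEq E] (G : MultiGraph V E) {a b c : V}
    (hG : G.IsHubPairGraph a b c) (p : E → ℝ) (hp : IsProb p) :
    (G.law3 p a b c 0 + G.law3 p a b c 1) * (G.law3 p a b c 1 + G.law3 p a b c 4) ≤
      G.law3 p a b c 1 + G.law3 p a b c 2 + G.law3 p a b c 3 := by
  classical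
  refine c026_of_dFree_minors G a b c (fun u v _ => ?_) p hp
  by_cases h : G.sureClass v a = G.sureClass v b ∨ G.sureClass v a = G.sureClass v c ∨
      G.sureClass v b = G.sureClass v c
  · exact dFreeIneq_of_marks_eq _ h
  · exact dFreeIneq_of_hubPair (G.minor u v) (hG.minor u v) (fun h1 => h (Or.inl h1))
      (fun h2 => h (Or.inr (Or.inl h2))) (fun h3 => h (Or.inr (Or.inr h3)))

end MultiGraph

end PercRepro
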